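import Literature.Analysis.FluidPDE.ClassicalSolution
import HarnessLib

/-!
# Backward uniqueness of bounded finite-energy classical Navier–Stokes solutions on `ℝ³` (named fact)

Analysis/FluidPDE literature file. It vendors, as ONE named fact and with NOTHING asserted, the
backward-uniqueness theorem for the free incompressible Navier–Stokes system on the whole space in
the class of classical solutions with bounded velocity and bounded energy:

> two classical solutions of `∂ₜu + (u·∇)u = νΔu − ∇p`, `div u = 0` on `[0, T] × ℝ³` (`ν > 0`),
> each bounded and of uniformly bounded energy on the slab, which coincide at time `T`, coincide
> at time `0`.

Sources and derivation (the statement is the whole-space, classical-class corollary of the abstract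
log-convexity theorem; each step is in print):

* **Abstract backward uniqueness (log-convexity of the Dirichlet quotient).** C. Bardos, L. Tartar,
  *Sur l'unicité rétrograde des équations paraboliques et quelques questions voisines*, Arch.
  Rational Mech. Anal. 50 (1973) 10–25, Thm. II.1; in the sharpened form of I. Kukavica, *Log-log
  convexity and backward uniqueness*, Proc. AMS 135 (2007) 2415–2421, **Thm. 2.1** (p. 2417), case
  `α = β = 0`: `H` a Hilbert space, `A` symmetric with `(Au, u) ≥ 0`,
  `u ∈ C([T₀, 0]; D(A)) ∩ C¹([T₀, 0]; H)`, `u′ + Au = f`, `‖f‖ ≤ K₁ ‖A^{1/2} u‖ + K₂ ‖u‖`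
  (hypothesis (1); hypothesis (2) then holds with `K₃ = K₁`, `K₄ = K₂`) ⟹ (`u(0) = 0 ⇒ u ≡ 0` on
  `[T₀, 0]`).
* **Application to the difference of two solutions.** With `w = u₁ − u₂`, `H = L²_σ(ℝ³)`,
  `A = −νPΔ` (`P` the Leray projector), `w′ + Aw = −P(w·∇u₁ + u₂·∇w)` and
  `‖P(w·∇u₁ + u₂·∇w)‖₂ ≤ ‖∇u₁‖_∞ ‖w‖₂ + ‖u₂‖_∞ ν^{-1/2} ‖A^{1/2} w‖₂` on every `[δ, T]`, `δ > 0`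
  (P. Constantin, C. Foias, *Navier–Stokes Equations* (1988), Ch. 12, Thm. 12.2 and its proof for
  the bounded/periodic case; the whole-space case is identical once `∇u₁ ∈ L^∞` and
  `w ∈ C([δ,T]; H²) ∩ C¹([δ,T]; L²)`).
* **Regularity inputs in this class.** A classical solution on `[0, T] × ℝ³` with bounded energy is
  a Leray–Hopf weak solution with the physical (normalised) pressure (T. Tao, *Localisation and
  compactness properties of the Navier–Stokes global regularity problem*, Anal. PDE 6 (2013),
  Lemma 8.1 — tree `IsClassicalNSSolutionOn.isLerayHopfOn_of_finiteEnergy`); a bounded Leray–Hopf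
  solution has bounded derivatives of every order on `[δ, T] × ℝ³` for each `δ > 0` (J. Serrin,
  Arch. Rational Mech. Anal. 9 (1962), interior regularity in the class `L^∞_t L^∞_x`); the
  conclusion at `t = 0` follows from `[δ, T]` by continuity of the slices (joint smoothness on the
  closed slab).

* `ns_backward_uniqueness_finiteEnergy` — the named fact, in the tree's classical-solution
  vocabulary (`IsClassicalNSSolutionOn (Icc 0 T) ν 0 u p`, bounded velocity, bounded energy as in
  `tao_pressure_normalisation` / the `Stage` class of the Pałasek tower files).
* No corollaries are proved here (statement-only file); the consumer applies the fact directly.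

## Conventions / faithfulness notes

* **Class.** Printed backward-uniqueness theorems are stated for strong solutions on bounded or
  periodic domains (Constantin–Foias Thm. 12.2; Kukavica §3.3) or abstractly (Bardos–Tartar,
  Kukavica Thm. 2.1); the fact below is the whole-space corollary in the smallest class used by the
  tree (bounded classical solutions of bounded energy), where the two regularity inputs above put
  the difference `w` in the domain of the abstract theorem on every `[δ, T]`. Nothing asserted: an
  unproved published result used as a hypothesis `(h : ns_backward_uniqueness_finiteEnergy)`.
* **Force.** Free system only (`f = 0`), as needed by its consumer (crux-chain file
  `Summits/NavierStokesRegularity/NavierStokesRegularity/Cruxes/EpisodeBase/Lines/robustmirror.lean`,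
  theorem `liveDatumPropagatesT_of_backwardUniqueness`: a dead readout slice of an unforced
  registered design forces a dead datum). The same proof covers a common smooth force.
* **Only the time-`0` slice is concluded** (weakest useful form); equality on all of `[0, T]` follows
  by applying the fact on `[0, t]`.
-/

noncomputable section

open MeasureTheory Set

open scoped ENNReal

namespace Literature.Analysis.FluidPDE

/-- **Backward uniqueness for bounded finite-energy classical solutions of the free Navier–Stokes
system on `ℝ³`** (Bardos–Tartar 1973, Thm. II.1; Kukavica 2007, Thm. 2.1 with `α = β = 0`, applied
to `w = u₁ − u₂` in `L²_σ(ℝ³)` with `A = −νPΔ`; regularity inputs Tao 2013 Lemma 8.1 and Serrin 1962).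
Let `ν > 0`, `T > 0`, and let `(u₁, p₁)`, `(u₂, p₂)` be classical solutions of the unforced system on
`[0, T] × ℝ³` (`IsClassicalNSSolutionOn (Icc 0 T) ν 0 uᵢ pᵢ`), each with bounded velocity
`sup_{[0,T] × ℝ³} |uᵢ| < ∞` and bounded energy `sup_{t ∈ [0,T]} ∫ |uᵢ(t)|² < ∞`. If
`u₁(T) = u₂(T)` then `u₁(0) = u₂(0)`. Nothing asserted.
[cite: BardosTartar1973, Thm. II.1] [cite: Kukavica2007, Thm. 2.1 (p. 2417)] -/
def ns_backward_uniqueness_finiteEnergy : Prop :=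
  ∀ (ν T : ℝ), 0 < ν → 0 < T →
    ∀ (u₁ u₂ : ℝ → EuclideanSpace ℝ (Fin 3) → EuclideanSpace ℝ (Fin 3))
      (p₁ p₂ : ℝ → EuclideanSpace ℝ (Fin 3) → ℝ),
      IsClassicalNSSolutionOn (Icc 0 T) ν 0 u₁ p₁ → IsClassicalNSSolutionOn (Icc 0 T) ν 0 u₂ p₂ →
      (∃ C : ℝ, ∀ t ∈ Icc 0 T, ∀ x, ‖u₁ t x‖ ≤ C) → (∃ C : ℝ, ∀ t ∈ Icc 0 T, ∀ x, ‖u₂ t x‖ ≤ C) →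
      (∃ A : ℝ≥0∞, A < ⊤ ∧ ∀ t ∈ Icc 0 T, ∫⁻ x, ‖u₁ t x‖ₑ ^ 2 ≤ A) →
      (∃ A : ℝ≥0∞, A < ⊤ ∧ ∀ t ∈ Icc 0 T, ∫⁻ x, ‖u₂ t x‖ₑ ^ 2 ≤ A) →
      u₁ T = u₂ T → u₁ 0 = u₂ 0


end Literature.Analysis.FluidPDE

end
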